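import Summits.QuantumFields.BalabanUV.T4Continuum.Support.OutputRateGaussianParamBi

/-!
# OutputRateGaussianParamBiEnd — the ONE-shape END with the termwise MAJORANT binder `TermBound` ALSO produced (from the Gaussian mass
# budget), and the consistency `TermOpGaussian ⟹ TermOpGaussianParam` (the one-integral Gaussian shape is the `Unit`-parameter sub-case)
# (cell `pub-balaban`, T⁴ fan-out, `HOME/BINDER-OWNERS.md` row NE5, owner lineage t4-ne5-p1, gen 29, route P1)

HONEST FRAMING (T4-DAG PAGE 1).  Rung (B)+1 on ONE finite four-torus — NOT infinite volume, NOT a mass gap, NOT the Clay problem;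
`FlowStep.BetaPertH`, (B), (B^μ) do not occur here.  NE5 is NOT PRINTED and NOT PROVED (spine 0/9).  Nothing of Bałaban's series is asserted;
0 cite tags ([II] = [Balaban1988RG2Cluster] p. 15 (2.14), p. 20/21 (2.38)–(2.41): the termwise majorants and their summation — printed KIND
of `TermBound`/`TermBudget`, quoted in the leaf `T4InputCauchyRateTermwise`).  HONEST DEPENDENCY (cell, verbatim): continuum YM on T⁴ ⇐
BetaPertH ∧ nine spine estimates (0/9 proved); BetaPertH ⇐ (D1) ∧ (D4) ∧ CAP+tail; G-an2-4 gates asym, D1 and NE2/3/4.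

WHAT THIS MODULE IS.
* §1 `termBound_of_bi` — `TermGaussianParamBi` (p214940) + room + the MASS budget
  `paramMass ≤ a k i·e^{−κd(X)}` (with `G₀ = F·e^{N₁‖h‖}`) ⟹ `TermBound (ballClass ctr ROp RHist) T W κ a` (by `termBound_of_gaussianParam` of
  p214635 through `termOpGaussianParam_of_bi`).
* §2 END **`ne5_at_of_stepModel_termwise_gaussianParamBi_mass_scale_nat`** — `OutputRateGaussianParamBi.ne5_at_of_stepModel_termwise_
  gaussianParamBi_budget_scale_nat` with its binder `hbd : TermBound …` REPLACED by the arithmetic mass budget `hmass`; every other binder BY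
  NAME; SAME smallness, SAME constant; conclusion `T4OutputRate.NE5` LITERALLY.  Displayed after this face, for (2.14)-shaped terms: MI-R,
  base budget, `TermRep` (the convergent expansion IS the output), `TermBudget` (summability of the weights `a k i` — the (2.38)–(2.41)
  combinatorics), one-run levels, W1, W4, insertion structure, W3, R, S, and the letters of the ONE shape.
* §3 `termOpGaussianParam_of_gaussian` — CONSISTENCY: the one-integral shape `OutputRateOpGaussian.TermOpGaussian` (p213354) implies
  `TermOpGaussianParam` with parameter space `Unit` (Dirac mass), `w = N = 1`, `b = 0`, `w₀ = N₀ = 1` (Mathlib's `integral_dirac`).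
0 sorry; axioms ⊆ {propext, Classical.choice, Quot.sound}.  NE5 NOT PROVED; 0/12 leaves on Bałaban's concrete objects; spine 0/9; rung (B)+1
finite T⁴; NOT infinite volume / mass gap / Clay.
-/

noncomputable section

open Set Metric MeasureTheory Filter

namespace Summit.QuantumFields.BalabanUV.T4Continuum.OutputRateGaussianParamBiEnd

open Literature.MathematicalPhysics.QuantumFieldTheory.Balaban1983to89
open Literature.MathematicalPhysics.QuantumFieldTheory.Balaban1983to89.T4OutputRate
open Literature.MathematicalPhysics.QuantumFieldTheory.Balaban1983to89.T4InputCauchyRate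
open Literature.MathematicalPhysics.QuantumFieldTheory.Balaban1983to89.T4InputCauchyRateData
open Literature.MathematicalPhysics.QuantumFieldTheory.Balaban1983to89.T4InputCauchyRateSpecies
open Literature.MathematicalPhysics.QuantumFieldTheory.Balaban1983to89.T4InputCauchyRateTermwise
open Summit.QuantumFields.BalabanUV.T4Continuum.OutputRateOpHolomorphic
open Summit.QuantumFields.BalabanUV.T4Continuum.OutputRateOpGaussian
open Summit.QuantumFields.BalabanUV.T4Continuum.OutputRateOpGaussianParam
open Summit.QuantumFields.BalabanUV.T4Continuum.OutputRateGaussianParamBi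

variable {C : Carriers} {Op Hist : Type*} [NormedAddCommGroup Op] [NormedSpace ℂ Op] [NormedAddCommGroup Hist]
  [NormedSpace ℂ Hist] {ι : Type*} {M : StepModel C Op Hist} {T : ℕ → ι → Op → Hist → C.Dom → ℂ}
  {β : ℕ → ι → Type*} [∀ k i, MeasurableSpace (β k i)]
  {α : ℕ → ι → Type*} [∀ k i, NormedAddCommGroup (α k i)] [∀ k i, InnerProductSpace ℝ (α k i)]
  [∀ k i, FiniteDimensional ℝ (α k i)] [∀ k i, MeasurableSpace (α k i)] [∀ k i, BorelSpace (α k i)]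

/-! ## §1 `TermBound` produced from the ONE shape and the mass budget -/

/-- **`TermBound` FROM THE ONE SHAPE + THE MASS BUDGET**: if every term is `TermGaussianParamBi` with room `ROp k < R′ k` and, for every history
datum `h` of the class's history ball, `paramMass α lam m b w₀ N₀ (F·e^{N₁‖h‖}) k i h X ≤ a k i·e^{−κd(X)}`, then `TermBound (ballClass ctr ROp RHist)
T W κ a`. [folklore] -/
theorem termBound_of_bi {W : Set (ℕ → ℝ)} {ctr : ℕ → (ℕ → ℝ) → C.BgB → Op × Hist} {ROp RHist R' : ℕ → ℝ}
    {lam : ∀ k i, C.Dom → Measure (β k i)} {w : ∀ k i, C.Dom → β k i → ℂ} {N : ∀ k i, C.Dom → Op → β k i → ℂ}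
    {F₀ : ∀ k i, C.Dom → β k i → α k i → ℂ} {Λ : ∀ k i, C.Dom → β k i → α k i → (Hist →L[ℂ] ℂ)}
    {q : ∀ k i, C.Dom → Op → β k i → α k i → ℂ} {m b w₀ N₀ F N₁ : ℕ → ι → C.Dom → ℝ} (hroom : ∀ k, ROp k < R' k)
    (hBi : TermGaussianParamBi T W ctr RHist R' lam w N F₀ Λ q m b w₀ N₀ F N₁) {κ : ℝ} {a : ℕ → ι → ℝ}
    (hmass : ∀ k, ∀ g ∈ W, ∀ (U : C.BgB), ∀ h ∈ closedBall (ctr k g U).2 (RHist k), ∀ X : C.Dom, C.scale X = k → ∀ i,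
      paramMass α (fun k i (_ : Hist) X => lam k i X) (fun k i (_ : Hist) X => m k i X) (fun k i (_ : Hist) X => b k i X)
        (fun k i (_ : Hist) X => w₀ k i X) (fun k i (_ : Hist) X => N₀ k i X)
        (fun k i h X => F k i X * Real.exp (N₁ k i X * ‖h‖)) k i h X ≤ a k i * Real.exp (-(κ * C.d X))) :
    TermBound (ballClass ctr ROp RHist) T W κ a :=
  termBound_of_gaussianParam hroom (termOpGaussianParam_of_bi hBi) hmass

/-! ## §2 END face with `hball`, `hexp` AND `hbd` produced -/

variable (M T) in
/-- **NE5 FROM THE ONE (2.14)-SHAPE WITH THE TERMWISE MAJORANT ALSO PRODUCED** — `ne5_at_of_stepModel_termwise_gaussianParamBi_budget_scale_nat`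
with `hbd : TermBound …` REPLACED by the mass budget `hmass` (§1); every other binder BY NAME and unchanged; SAME smallness
`ω + G·c/(1 − ρ₀) < θ′`, SAME constant; conclusion `T4OutputRate.NE5` LITERALLY.  NOT a proof of NE5 for Bałaban's step. [folklore] -/
theorem ne5_at_of_stepModel_termwise_gaussianParamBi_mass_scale_nat {EA : Functional C C.BgA} {EB : Functional C C.BgB}
    {W : Set (ℕ → ℝ)} {ctr : ℕ → (ℕ → ℝ) → C.BgB → Op × Hist} {BOp BHist ROp RHist R' : ℕ → ℝ} {a : ℕ → ι → ℝ}
    {lam : ∀ k i, C.Dom → Measure (β k i)} {w : ∀ k i, C.Dom → β k i → ℂ} {N : ∀ k i, C.Dom → Op → β k i → ℂ}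
    {F₀ : ∀ k i, C.Dom → β k i → α k i → ℂ} {Λ : ∀ k i, C.Dom → β k i → α k i → (Hist →L[ℂ] ℂ)}
    {q : ∀ k i, C.Dom → Op → β k i → α k i → ℂ} {m b w₀ N₀ F N₁ : ℕ → ι → C.Dom → ℝ}
    {κ G EA₀ E₀ E₁ δ δ' θ θ' c ω ρ₀ B : ℝ} {k₀ : ℕ}
    (hrA : M.RepresentsA EA W) (hrB : M.RepresentsB EB W) (hbase : M.InBase EB W) (hbudget : BaseBudget M W ctr BOp BHist)
    (hOp : ∀ k, BOp k + M.rOp k ≤ ROp k) (hHist : ∀ k, BHist k + M.rHist k ≤ RHist k)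
    (hrep : TermRep M (ballClass ctr ROp RHist) T W) (hbud : TermBudget a G) (hroom : ∀ k, ROp k < R' k)
    (hBi : TermGaussianParamBi T W ctr RHist R' lam w N F₀ Λ q m b w₀ N₀ F N₁)
    (hmass : ∀ k, ∀ g ∈ W, ∀ (U : C.BgB), ∀ h ∈ closedBall (ctr k g U).2 (RHist k), ∀ X : C.Dom, C.scale X = k → ∀ i,
      paramMass α (fun k i (_ : Hist) X => lam k i X) (fun k i (_ : Hist) X => m k i X) (fun k i (_ : Hist) X => b k i X)
        (fun k i (_ : Hist) X => w₀ k i X) (fun k i (_ : Hist) X => N₀ k i X)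
        (fun k i h X => F k i X * Real.exp (N₁ k i X * ‖h‖)) k i h X ≤ a k i * Real.exp (-(κ * C.d X)))
    (hdA : DecayBound EA W EA₀ κ) (hdB : DecayBound EB W E₀ κ) (hop : M.OperatorRate W δ θ)
    (hins : M.InsertionRate W κ E₀ δ' θ) (haff : M.InsAffine W) (hblind : M.InsBlind W) (hhom : M.InsHomog W)
    (hunit : M.InsScaleBound W κ E₁ c ω) (hE₁ : 0 < E₁) (hG0 : 0 ≤ G) (hδ : 0 ≤ δ) (hδ' : 0 ≤ δ') (hθ : 0 ≤ θ)
    (hθθ' : θ ≤ θ') (hθ'1 : θ' ≤ 1) (hc : 0 ≤ c) (hω : 0 < ω) (hρ₀ : ρ₀ < 1)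
    (hnear : (δ + δ') * θ ^ k₀ + c * (EA₀ + E₀) / (1 - ω) ≤ ρ₀) (hB : 0 ≤ B) (hfirst : ∀ k < k₀, EA₀ + E₀ ≤ B * θ ^ k)
    (hsmall : ω + G / (1 - ρ₀) * c < θ') :
    NE5 EA EB W κ θ' ((G / (1 - ρ₀) * δ + G / (1 - ρ₀) * δ' + B) * (θ' - ω) / (θ' - (ω + G / (1 - ρ₀) * c))) :=
  ne5_at_of_stepModel_termwise_gaussianParamBi_budget_scale_nat M T hrA hrB hbase hbudget hOp hHist hrep
    (termBound_of_bi hroom hBi hmass) hbud hroom hBi hdA hdB hop hins haff hblind hhom hunit hE₁ hG0 hδ hδ' hθ hθθ' hθ'1 hc hω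
    hρ₀ hnear hB hfirst hsmall

/-! ## §3 Consistency: the one-integral Gaussian shape is the `Unit`-parameter sub-case -/

omit [∀ k i, MeasurableSpace (β k i)] [NormedSpace ℂ Hist] in
/-- **`TermOpGaussian ⟹ TermOpGaussianParam`** with parameter space `Unit` carrying the Dirac mass, Cauchy weight and prefactor `1`, shift
`b = 0`, bounds `w₀ = N₀ = 1` — the gen-28 one-integral shape is the sub-case of the parametrised one (`integral_dirac`). [folklore] -/
theorem termOpGaussianParam_of_gaussian {W : Set (ℕ → ℝ)} {ctr : ℕ → (ℕ → ℝ) → C.BgB → Op × Hist} {RHist R' : ℕ → ℝ}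
    {gIns : ∀ k i, Hist → C.Dom → α k i → ℂ} {q : ∀ k i, Hist → C.Dom → Op → α k i → ℂ} {m G₀ : ℕ → ι → Hist → C.Dom → ℝ}
    (hG : TermOpGaussian T W ctr RHist R' gIns q m G₀) :
    TermOpGaussianParam (β := fun _ _ => Unit) T W ctr RHist R' (fun _ _ _ _ => Measure.dirac ()) (fun _ _ _ _ _ => 1)
      (fun _ _ _ _ _ _ => 1) (fun k i h X _ v => gIns k i h X v) (fun k i h X o _ v => q k i h X o v) m (fun _ _ _ _ => 0)
      (fun _ _ _ _ => 1) (fun _ _ _ _ => 1) G₀ := by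
  intro k g hg U h hh X hX i
  obtain ⟨hm, hgm, hgb, hqm, hqh, hqre, hrepr⟩ := hG k g hg U h hh X hX i
  refine ⟨by infer_instance, hm, aestronglyMeasurable_const, fun _ => by simp, fun _ _ => aestronglyMeasurable_const,
    fun _ => differentiableOn_const _, fun _ _ _ => by simp,
    (hgm.aemeasurable.comp_snd (μ := Measure.dirac ())).aestronglyMeasurable, fun _ v => hgb v,
    fun o ho => ((hqm o ho).aemeasurable.comp_snd (μ := Measure.dirac ())).aestronglyMeasurable, fun _ v => hqh v,
    fun o ho _ v => by rw [sub_zero]; exact hqre o ho v, fun o ho => ?_⟩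
  rw [hrepr o ho, integral_dirac]
  simp

end Summit.QuantumFields.BalabanUV.T4Continuum.OutputRateGaussianParamBiEnd

end
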